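import Summits.QuantumFields.BalabanUV.Beta.CombChartJointEndReflTablesAn1S2M
import Summits.QuantumFields.BalabanUV.Beta.SymWardLettersAn1

/-!
# `BalabanUV.Beta.CombChartJointEndReflTablesAn1S2MW` — binder row D1, RULING R-D1-g35-1 (chart (III′)), programme P6: **THE (III′) TWIN OF chart (II)'s ROOT `RowD1JointEndSymReflTablesAn1S2MW`** — the same
# root-level REDUCTION STEP performed on the chart-(III′) repair track (literal `JsB12CombShSym`, resolvents `GcombSh Lc j`, an1's shift `Dsh Lc`), consuming the
# SAME table-level suppliers BY NAME and the (III′) engine twins (`…Comb` files of this gen) where chart (II) consumed the `…Sym` engines; chart (II)'s displayed scalar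
# identity `hcomp` is REPLACED throughout by the repair track's `hRm0 : tadpole (GcombSh Lc j) (Rm_j …) = 0` (P5) at the same W-remainder `Rm_j`.
# WHAT CHANGES relative to `RowD1JointEndSymReflTablesAn1S2MW`: nothing but these substitutions (text transformed by name; see that file's docstring for the letter-by-letter account).

HONEST FRAMING (cell contract, verbatim): «discharging `BetaPertH` makes Bałaban's UV stability UNCONDITIONAL — a real constructive-QFT
result; it is NOT the continuum limit and NOT the Clay problem.»  HONEST DEPENDENCY: continuum YM on T⁴ ⇐ BetaPertH ∧ nine spine estimates (0/9 proved);
BetaPertH ⇐ (D1) ∧ (D4) ∧ CAP+tail; G-an2-4 gates asym, D1 and NE2/3/4.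
DERIVED cell leaf ([folklore] wiring BY NAME; β sub-cell, BINDER-OWNERS row D1 OWNER `b2b-balaban-beta-an2` gen 36).  No statement of Bałaban's papers, no `[cite:]`,
no `Prop` fact, no `def`; every displayed letter is a BINDER.  THIS IS THE REPAIR TRACK (RULING R-D1-g35-1 (5)): the RECORD stays ROOT M′ p303989 over `JsB12Sym`.
HONEST: composition by name; repair-track root classes {hW∕hR table letters, `hRm0`, D1Tel, D1Rep} 0∕4 discharged; row D1 binders 0∕4; NOT D1, NOT `BetaPertH`,
NOT continuum, NOT Clay.  Provenance: β sub-cell, unit beta-an2 gen 36, 2026-08-22 (v1); no existing file touched.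
-/

noncomputable section

open Finset
open scoped BigOperators
open Literature.Probability.LatticeModels (Torus.proj)
open Literature.MathematicalPhysics.QuantumFieldTheory
open Literature.MathematicalPhysics.QuantumFieldTheory.Balaban1983to89
open Literature.MathematicalPhysics.QuantumFieldTheory.Balaban1983to89.Beta
open Literature.MathematicalPhysics.QuantumFieldTheory.Balaban1983to89.Beta.VectorTailsLoc (fam kfam)
open Literature.MathematicalPhysics.QuantumFieldTheory.Balaban1983to89.Beta.VectorLegVolumeAdapter (MvE)
open ExpKernelCalculus (MKer BiLoc VertexFamily comp tr tadpole shiftK)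
open PolarizationSign (reflSign WardTransversal AxisReflectionCovariant)
open KernelReflection (refK)
open ResolventReflection (bref Φ)
open AffineAveraging (box toSite)
open AveragingContoursRooted (ctr ctrOff ctrOff_mem_box)
open OneStepResolventKernel (Fib LocStencil JetData)
open OneStepKernelFamily (KInvStep colH vertexOfK TbalOf flipK D1Tel D1Rep D1Drift)
open KernelWard (divV divW)
open StepJetData (mfNeg wilsonA)
open BalabanStepJetsSucc (mmRead wE wVH)
open SecondOrderResponse (dM W2OfK LocStencilFM)
open BalabanCompositeJets (LocStencil₂)
open BalabanStepW2 (M2Of wB2 wV4)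
open WilsonBiStencil (wilsonW₂)
open WilsonVertex2Sym (wsym22)
open Summit.QuantumFields.BalabanUV.Beta.TameKernelCalculus
open Summit.QuantumFields.BalabanUV.Beta.ChartConjugation (conjV conjW)
open Summit.QuantumFields.BalabanUV.Beta.ChartConjugationDefectEnd (conjDefect sandwichDefect)
open Summit.QuantumFields.BalabanUV.Beta.AxialDressingRooted (one_le_of_neZero)
open Summit.QuantumFields.BalabanUV.Beta.SymmetrisedDressingKernel (coDressKSymAt)
open Summit.QuantumFields.BalabanUV.Beta.AveragingWardRootedStencils (legInd)
open Summit.QuantumFields.BalabanUV.Beta.SymmetrisedStepJets (SymTables)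
open Summit.QuantumFields.BalabanUV.Beta.CombChartStepJets (GcombSh ScombOf SpureCombOf JsB12CombSh0)
open Summit.QuantumFields.BalabanUV.Beta.CombChartJointEnd (JsB12CombShSym)
open Summit.QuantumFields.BalabanUV.Beta.SpineRooted (M1Of SpureRecOf T2RecOf WrecOf)
open Summit.QuantumFields.BalabanUV.Beta.WardLocusRecursive (SrecOf)
open Summit.QuantumFields.BalabanUV.Beta.WardLocusCubic (mmSym)
open Summit.QuantumFields.BalabanUV.Beta.SymShiftedSpread (bhKStepSh)
open Summit.QuantumFields.BalabanUV.Beta.BorderedHessian (sgnK bhK stepScale diagK)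
open Summit.QuantumFields.BalabanUV.Beta.E3ContactGenerator (ctGenM)
open Summit.QuantumFields.BalabanUV.Beta.DshAn1 (Dsh)
open Summit.QuantumFields.BalabanUV.Beta.SymAveragingHessianCounts (symVhSAt symHessFFAt)
open Summit.QuantumFields.BalabanUV.Beta.SymAveragingMixedJetTables (symMixFFAt)
open Summit.QuantumFields.BalabanUV.Beta.SymSecondOrderTablesAn1 (symVh₂SAn1 symTablesAn1S2 locStencil₂_symVh₂SAn1 symVh₂SAn1_hBt symVh₂SAn1_inl_inl
  symMixFFAt_hmix_ctr symMixFFAt_hmixt)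
open Summit.QuantumFields.BalabanUV.Beta.CombChartJointEndReflTablesAn1S2 (d1Drift_JsB12CombShSym_an1TablesS2_of_bordMixLetters_reflTableLettersRem_D1Tel_D1Rep)
open Summit.QuantumFields.BalabanUV.Beta.SymMixedReflectionLetterAn1 (symRMrAn1 hM2_symMixFFAt)

open Summit.QuantumFields.BalabanUV.Beta.CombChartJointEndReflTablesAn1S2M (d1Drift_JsB12CombShSym_an1TablesS2_of_bordMixWard_bordReflLetters_D1Tel_D1Rep)
open Summit.QuantumFields.BalabanUV.Beta.SymWardLettersAn1 (symRMAn1 hcls_sym hRBp_zero hRMp_sym_of_lock hBord0_sym hBord0''_sym hBordS_sym hBordS''_sym hM₂_sym)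

namespace Summit.QuantumFields.BalabanUV.Beta.CombChartJointEndReflTablesAn1S2MW

variable {Lc : ℕ} [NeZero Lc]

/-- **ROW D1 — THE LITERAL ROOT AT an1's CLOSED TABLE RECORD `symTablesAn1S2 3 Lc cΛ` WITH THE hW CLASS DISCHARGED** at the locks `cΛ·Lc⁴ = 2`, `cB = −Lc¹²∕4`:
`CombChartJointEndReflTablesAn1S2M.d1Drift_…_bordMixWard_bordReflLetters_…` with `RB := 0`, `RB'' := 0`, `RM := symRMAn1 Lc cΛ`, `hcls0 := hcls_sym _ cΛ 0`,
`hclsS := fun j => hcls_sym _ cΛ (j+1)`, `hRBp := hRBp_zero`, `hRB''p := hRBp_zero`, `hRMp := hRMp_sym_of_lock hΛ`, `hBord0∕hBord0''∕hBordS∕hBordS'' := …_sym hLc`,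
`hM₂ := hM₂_sym cΛ` (an1-g43's S2d #25) — thirteen binders fewer, two unit-lock hypotheses more.  HONEST: composition by name; NOT D1. -/
theorem d1Drift_JsB12CombShSym_an1TablesS2_of_bordReflLetters_D1Tel_D1Rep_of_locks (hLc : Odd Lc) (hL2 : 2 ≤ Lc) {N : ℕ} (hN : 2 ≤ N) (cΛ cB : ℝ)
    -- the two unit locks of an1's TABLE-FIT tier 2 (Λ-lock of `SymMixedWardSiteLaw.symBondWardM`, B-lock of `SymBorderWardSiteLaw.symBondWardB`)
    (hΛ : cΛ * (Lc : ℝ) ^ 4 = 2) (hcB : cB = -((Lc : ℝ) ^ 12 / 4))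
    -- hR, first order: the REFLECTION letters (V-r)(H-r) of an1's concrete first-order sym tables (pinned contact generator) — an1's reflection step, displayed
    (hVfm : ∀ (α κ' : Fin 4) (u x z : Fin 4 → ℤ) (β m : Fin 4), symVhSAt (ctr 4 Lc) 3 Lc rfl κ' (bref α κ' u) x z (Sum.inl β) (Sum.inr m) =
      (reflSign α κ' • refK (Φ (d := 3) Lc α) (symVhSAt (ctr 4 Lc) 3 Lc rfl κ' u + conjV (bhK (d := 3) Lc + Dsh Lc)
        ((((Lc : ℝ) ^ 4)⁻¹) • diagK (ctGenM 3 (bhK Lc + Dsh Lc) α Lc κ' u)))) x z (Sum.inl β) (Sum.inr m))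
    (hVmf : ∀ (α κ' : Fin 4) (u x z : Fin 4 → ℤ) (m β : Fin 4), symVhSAt (ctr 4 Lc) 3 Lc rfl κ' (bref α κ' u) x z (Sum.inr m) (Sum.inl β) =
      (reflSign α κ' • refK (Φ (d := 3) Lc α) (symVhSAt (ctr 4 Lc) 3 Lc rfl κ' u + conjV (bhK (d := 3) Lc + Dsh Lc)
        ((((Lc : ℝ) ^ 4)⁻¹) • diagK (ctGenM 3 (bhK Lc + Dsh Lc) α Lc κ' u)))) x z (Sum.inr m) (Sum.inl β))
    (hVmm : ∀ (α κ' : Fin 4) (u x z : Fin 4 → ℤ) (m m' : Fin 4), symVhSAt (ctr 4 Lc) 3 Lc rfl κ' (bref α κ' u) x z (Sum.inr m) (Sum.inr m') =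
      (reflSign α κ' • refK (Φ (d := 3) Lc α) (symVhSAt (ctr 4 Lc) 3 Lc rfl κ' u + conjV (bhK (d := 3) Lc + Dsh Lc)
        ((((Lc : ℝ) ^ 4)⁻¹) • diagK (ctGenM 3 (bhK Lc + Dsh Lc) α Lc κ' u)))) x z (Sum.inr m) (Sum.inr m'))
    (hHr : ∀ (α μ : Fin 4) (y : Fin 4 → ℤ),
      symHessFFAt (ctr 4 Lc) Lc μ (bref α μ y) = reflSign α μ • refK (Φ (d := 3) Lc α) (symHessFFAt (ctr 4 Lc) Lc μ y))
    -- the first-order contact coefficient, displayed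
    (γ : ℕ → ℝ) (hγ : ∀ j, γ j = -((Lc : ℝ) ^ 8 / 2) * wVH 3 Lc j / (stepScale 3 Lc j * (Lc : ℝ) ^ 4))
    -- hR, SECOND ORDER, NOW TABLE-LEVEL: (hB0) the border table's zero field block, the second units lock, and the second-order TABLE reflection letters
    -- (level-0 letter, mixed letter ∀ j, border letter ∀ j+1), the mechanical split identities + localisations, the remainder recursion (with the four
    -- inner sandwich-defect words of `SecondOrderInverseShapeDefect.K3_sharp_defect`) — the hypotheses of `SpineRooted.WrecOf_brefC_of_tableLetters_comb`
    (hlock2 : ∀ j, ((Lc : ℝ) ^ 8) * wV4 3 Lc (j + 1) * wVH 3 Lc (j + 1) = ((Lc : ℝ) ^ 4 * wE 3 Lc (j + 1)) ^ 2)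
    (h2 : ℕ → Fin 4 → Fin 4 → (Fin 4 → ℤ) → Fin 4 → (Fin 4 → ℤ) → (Fin 4 → ℤ) → Fib 3 → ℝ)
    (R2 : ℕ → Fin 4 → Fin 4 → (Fin 4 → ℤ) → Fin 4 → (Fin 4 → ℤ) → MKer 4 (Fib 3))
    (h0 : ∀ (α κ : Fin 4) (u : Fin 4 → ℤ) (κ' : Fin 4) (u' : Fin 4 → ℤ),
      T2RecOf 3 Lc (GcombSh Lc) (SpureRecOf 3 Lc (symVhSAt (ctr 4 Lc) 3 Lc rfl) (symHessFFAt (ctr 4 Lc) Lc) (GcombSh Lc) ((Lc : ℝ) ^ 4) (-((Lc : ℝ) ^ 8 / 2)) cΛ) (M1Of 3 Lc (symHessFFAt (ctr 4 Lc) Lc) cΛ) ((Lc : ℝ) ^ 8) cB ((8 * (N : ℝ) ^ 2)⁻¹ • wsym22 N) (symVh₂SAn1 3 Lc) (symMixFFAt (ctr 4 Lc) Lc) 0 κ (bref α κ u) κ' (bref α κ' u') =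
        (reflSign α κ * reflSign α κ') • refK (Φ Lc α)
          (T2RecOf 3 Lc (GcombSh Lc) (SpureRecOf 3 Lc (symVhSAt (ctr 4 Lc) 3 Lc rfl) (symHessFFAt (ctr 4 Lc) Lc) (GcombSh Lc) ((Lc : ℝ) ^ 4) (-((Lc : ℝ) ^ 8 / 2)) cΛ) (M1Of 3 Lc (symHessFFAt (ctr 4 Lc) Lc) cΛ) ((Lc : ℝ) ^ 8) cB ((8 * (N : ℝ) ^ 2)⁻¹ • wsym22 N) (symVh₂SAn1 3 Lc) (symMixFFAt (ctr 4 Lc) Lc) 0 κ u κ' u' +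
            conjW (bhKStepSh 3 Lc (Dsh Lc) 0) (SpureRecOf 3 Lc (symVhSAt (ctr 4 Lc) 3 Lc rfl) (symHessFFAt (ctr 4 Lc) Lc) (GcombSh Lc) ((Lc : ℝ) ^ 4) (-((Lc : ℝ) ^ 8 / 2)) cΛ 0 κ u) (SpureRecOf 3 Lc (symVhSAt (ctr 4 Lc) 3 Lc rfl) (symHessFFAt (ctr 4 Lc) Lc) (GcombSh Lc) ((Lc : ℝ) ^ 4) (-((Lc : ℝ) ^ 8 / 2)) cΛ 0 κ' u')
              (diagK fun p c => γ 0 * ctGenM 3 (bhK Lc + Dsh Lc) α Lc κ u p c) (diagK fun p c => γ 0 * ctGenM 3 (bhK Lc + Dsh Lc) α Lc κ' u' p c) (diagK (h2 0 α κ u κ' u')) +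
            R2 0 α κ u κ' u'))
    (X2s : ℕ → Fin 4 → Fin 4 → (Fin 4 → ℤ) → Fin 4 → (Fin 4 → ℤ) → (Fin 4 → ℤ) → Fib 3 → ℝ)
    (Δ : ℕ → Fin 4 → Fin 4 → (Fin 4 → ℤ) → Fin 4 → (Fin 4 → ℤ) → MKer 4 (Fib 3))
    (hsplit : ∀ (j : ℕ) (α μ : Fin 4) (y : Fin 4 → ℤ) (ν : Fin 4) (y' : Fin 4 → ℤ),
      W2OfK (GcombSh (d := 3) Lc j) Lc
          (fun κ u => SpureRecOf 3 Lc (symVhSAt (ctr 4 Lc) 3 Lc rfl) (symHessFFAt (ctr 4 Lc) Lc) (GcombSh Lc) ((Lc : ℝ) ^ 4) (-((Lc : ℝ) ^ 8 / 2)) cΛ j κ u + conjV (bhKStepSh 3 Lc (Dsh Lc) j) (diagK fun p c => γ j * ctGenM 3 (bhK Lc + Dsh Lc) α Lc κ u p c))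
          (M1Of 3 Lc (symHessFFAt (ctr 4 Lc) Lc) cΛ j)
          (fun κ u κ' u' => T2RecOf 3 Lc (GcombSh Lc) (SpureRecOf 3 Lc (symVhSAt (ctr 4 Lc) 3 Lc rfl) (symHessFFAt (ctr 4 Lc) Lc) (GcombSh Lc) ((Lc : ℝ) ^ 4) (-((Lc : ℝ) ^ 8 / 2)) cΛ) (M1Of 3 Lc (symHessFFAt (ctr 4 Lc) Lc) cΛ) ((Lc : ℝ) ^ 8) cB ((8 * (N : ℝ) ^ 2)⁻¹ • wsym22 N) (symVh₂SAn1 3 Lc) (symMixFFAt (ctr 4 Lc) Lc) j κ u κ' u' +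
            conjW (bhKStepSh 3 Lc (Dsh Lc) j) (SpureRecOf 3 Lc (symVhSAt (ctr 4 Lc) 3 Lc rfl) (symHessFFAt (ctr 4 Lc) Lc) (GcombSh Lc) ((Lc : ℝ) ^ 4) (-((Lc : ℝ) ^ 8 / 2)) cΛ j κ u) (SpureRecOf 3 Lc (symVhSAt (ctr 4 Lc) 3 Lc rfl) (symHessFFAt (ctr 4 Lc) Lc) (GcombSh Lc) ((Lc : ℝ) ^ 4) (-((Lc : ℝ) ^ 8 / 2)) cΛ j κ' u')
              (diagK fun p c => γ j * ctGenM 3 (bhK Lc + Dsh Lc) α Lc κ u p c) (diagK fun p c => γ j * ctGenM 3 (bhK Lc + Dsh Lc) α Lc κ' u' p c) (diagK (h2 j α κ u κ' u')) +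
            R2 j α κ u κ' u')
          (fun κ u ρ w => M2Of 3 Lc (symMixFFAt (ctr 4 Lc) Lc) j κ u ρ w + conjV (M1Of 3 Lc (symHessFFAt (ctr 4 Lc) Lc) cΛ j ρ w) (diagK fun p c => γ j * ctGenM 3 (bhK Lc + Dsh Lc) α Lc κ u p c) + symRMrAn1 Lc cΛ γ j α κ u ρ w)
          μ y ν y' =
        W2OfK (GcombSh (d := 3) Lc j) Lc (SpureRecOf 3 Lc (symVhSAt (ctr 4 Lc) 3 Lc rfl) (symHessFFAt (ctr 4 Lc) Lc) (GcombSh Lc) ((Lc : ℝ) ^ 4) (-((Lc : ℝ) ^ 8 / 2)) cΛ j) (M1Of 3 Lc (symHessFFAt (ctr 4 Lc) Lc) cΛ j)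
            (T2RecOf 3 Lc (GcombSh Lc) (SpureRecOf 3 Lc (symVhSAt (ctr 4 Lc) 3 Lc rfl) (symHessFFAt (ctr 4 Lc) Lc) (GcombSh Lc) ((Lc : ℝ) ^ 4) (-((Lc : ℝ) ^ 8 / 2)) cΛ) (M1Of 3 Lc (symHessFFAt (ctr 4 Lc) Lc) cΛ) ((Lc : ℝ) ^ 8) cB ((8 * (N : ℝ) ^ 2)⁻¹ • wsym22 N) (symVh₂SAn1 3 Lc) (symMixFFAt (ctr 4 Lc) Lc) j)
            (M2Of 3 Lc (symMixFFAt (ctr 4 Lc) Lc) j) μ y ν y' +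
          conjW (bhKStepSh 3 Lc (Dsh Lc) j)
            (dM (GcombSh Lc j) Lc (SpureRecOf 3 Lc (symVhSAt (ctr 4 Lc) 3 Lc rfl) (symHessFFAt (ctr 4 Lc) Lc) (GcombSh Lc) ((Lc : ℝ) ^ 4) (-((Lc : ℝ) ^ 8 / 2)) cΛ j) (M1Of 3 Lc (symHessFFAt (ctr 4 Lc) Lc) cΛ j) μ y)
            (dM (GcombSh Lc j) Lc (SpureRecOf 3 Lc (symVhSAt (ctr 4 Lc) 3 Lc rfl) (symHessFFAt (ctr 4 Lc) Lc) (GcombSh Lc) ((Lc : ℝ) ^ 4) (-((Lc : ℝ) ^ 8 / 2)) cΛ j) (M1Of 3 Lc (symHessFFAt (ctr 4 Lc) Lc) cΛ j) ν y')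
            (diagK fun p c => ∑ κ, ∑' u, colH (GcombSh Lc j) Lc μ y κ u * (γ j * ctGenM 3 (bhK Lc + Dsh Lc) α Lc κ u p c))
            (diagK fun p c => ∑ κ, ∑' u, colH (GcombSh Lc j) Lc ν y' κ u * (γ j * ctGenM 3 (bhK Lc + Dsh Lc) α Lc κ u p c))
            (diagK (X2s j α μ y ν y')) +
          Δ j α μ y ν y')
    (hDg : ∀ (j : ℕ) (α ν : Fin 4) (y' : Fin 4 → ℤ),
      Loc (dM (GcombSh (d := 3) Lc j) Lc (fun κ u => SpureRecOf 3 Lc (symVhSAt (ctr 4 Lc) 3 Lc rfl) (symHessFFAt (ctr 4 Lc) Lc) (GcombSh Lc) ((Lc : ℝ) ^ 4) (-((Lc : ℝ) ^ 8 / 2)) cΛ j κ u + conjV (bhKStepSh 3 Lc (Dsh Lc) j) (diagK fun p c => γ j * ctGenM 3 (bhK Lc + Dsh Lc) α Lc κ u p c)) (M1Of 3 Lc (symHessFFAt (ctr 4 Lc) Lc) cΛ j) ν y'))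
    (hX2L : ∀ j α μ y ν y', Loc (diagK (X2s j α μ y ν y'))) (hΔL : ∀ j α μ y ν y', Loc (Δ j α μ y ν y'))
    (RBr : ℕ → Fin 4 → Fin 4 → (Fin 4 → ℤ) → Fin 4 → (Fin 4 → ℤ) → MKer 4 (Fib 3))
    (hRBrff : ∀ j α κ u κ' u' (x z : Fin 4 → ℤ) (β β' : Fin 4), RBr j α κ u κ' u' x z (Sum.inl β) (Sum.inl β') = 0)
    (hBfm : ∀ (j : ℕ) (α : Fin 4) κ u κ' u' (x z : Fin 4 → ℤ) (β m : Fin 4),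
      ((cB * wB2 3 Lc (j + 1)) • symVh₂SAn1 3 Lc κ (bref α κ u) κ' (bref α κ' u')) x z (Sum.inl β) (Sum.inr m) =
        ((reflSign α κ * reflSign α κ') • refK (Φ Lc α) ((cB * wB2 3 Lc (j + 1)) • symVh₂SAn1 3 Lc κ u κ' u' +
          conjW (bhKStepSh 3 Lc (Dsh Lc) (j + 1)) (SpureRecOf 3 Lc (symVhSAt (ctr 4 Lc) 3 Lc rfl) (symHessFFAt (ctr 4 Lc) Lc) (GcombSh Lc) ((Lc : ℝ) ^ 4) (-((Lc : ℝ) ^ 8 / 2)) cΛ (j + 1) κ u) (SpureRecOf 3 Lc (symVhSAt (ctr 4 Lc) 3 Lc rfl) (symHessFFAt (ctr 4 Lc) Lc) (GcombSh Lc) ((Lc : ℝ) ^ 4) (-((Lc : ℝ) ^ 8 / 2)) cΛ (j + 1) κ' u')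
            (diagK fun p c => γ (j + 1) * ctGenM 3 (bhK Lc + Dsh Lc) α Lc κ u p c) (diagK fun p c => γ (j + 1) * ctGenM 3 (bhK Lc + Dsh Lc) α Lc κ' u' p c)
            (diagK (h2 (j + 1) α κ u κ' u')) + RBr (j + 1) α κ u κ' u')) x z (Sum.inl β) (Sum.inr m))
    (hBmf : ∀ (j : ℕ) (α : Fin 4) κ u κ' u' (x z : Fin 4 → ℤ) (m β : Fin 4),
      ((cB * wB2 3 Lc (j + 1)) • symVh₂SAn1 3 Lc κ (bref α κ u) κ' (bref α κ' u')) x z (Sum.inr m) (Sum.inl β) =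
        ((reflSign α κ * reflSign α κ') • refK (Φ Lc α) ((cB * wB2 3 Lc (j + 1)) • symVh₂SAn1 3 Lc κ u κ' u' +
          conjW (bhKStepSh 3 Lc (Dsh Lc) (j + 1)) (SpureRecOf 3 Lc (symVhSAt (ctr 4 Lc) 3 Lc rfl) (symHessFFAt (ctr 4 Lc) Lc) (GcombSh Lc) ((Lc : ℝ) ^ 4) (-((Lc : ℝ) ^ 8 / 2)) cΛ (j + 1) κ u) (SpureRecOf 3 Lc (symVhSAt (ctr 4 Lc) 3 Lc rfl) (symHessFFAt (ctr 4 Lc) Lc) (GcombSh Lc) ((Lc : ℝ) ^ 4) (-((Lc : ℝ) ^ 8 / 2)) cΛ (j + 1) κ' u')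
            (diagK fun p c => γ (j + 1) * ctGenM 3 (bhK Lc + Dsh Lc) α Lc κ u p c) (diagK fun p c => γ (j + 1) * ctGenM 3 (bhK Lc + Dsh Lc) α Lc κ' u' p c)
            (diagK (h2 (j + 1) α κ u κ' u')) + RBr (j + 1) α κ u κ' u')) x z (Sum.inr m) (Sum.inl β))
    (hBmm : ∀ (j : ℕ) (α : Fin 4) κ u κ' u' (x z : Fin 4 → ℤ) (m m' : Fin 4),
      ((cB * wB2 3 Lc (j + 1)) • symVh₂SAn1 3 Lc κ (bref α κ u) κ' (bref α κ' u')) x z (Sum.inr m) (Sum.inr m') =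
        ((reflSign α κ * reflSign α κ') • refK (Φ Lc α) ((cB * wB2 3 Lc (j + 1)) • symVh₂SAn1 3 Lc κ u κ' u' +
          conjW (bhKStepSh 3 Lc (Dsh Lc) (j + 1)) (SpureRecOf 3 Lc (symVhSAt (ctr 4 Lc) 3 Lc rfl) (symHessFFAt (ctr 4 Lc) Lc) (GcombSh Lc) ((Lc : ℝ) ^ 4) (-((Lc : ℝ) ^ 8 / 2)) cΛ (j + 1) κ u) (SpureRecOf 3 Lc (symVhSAt (ctr 4 Lc) 3 Lc rfl) (symHessFFAt (ctr 4 Lc) Lc) (GcombSh Lc) ((Lc : ℝ) ^ 4) (-((Lc : ℝ) ^ 8 / 2)) cΛ (j + 1) κ' u')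
            (diagK fun p c => γ (j + 1) * ctGenM 3 (bhK Lc + Dsh Lc) α Lc κ u p c) (diagK fun p c => γ (j + 1) * ctGenM 3 (bhK Lc + Dsh Lc) α Lc κ' u' p c)
            (diagK (h2 (j + 1) α κ u κ' u')) + RBr (j + 1) α κ u κ' u')) x z (Sum.inr m) (Sum.inr m'))
    (hR2succ : ∀ (j : ℕ) (α κ : Fin 4) (u : Fin 4 → ℤ) (κ' : Fin 4) (u' : Fin 4 → ℤ),
      R2 (j + 1) α κ u κ' u' =
          (-((((Lc : ℝ) ^ 8) * wV4 3 Lc (j + 1)) • mmRead Lc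
              (comp (comp (GcombSh Lc j) (((1 / 2 : ℝ) • conjV (bhKStepSh 3 Lc (Dsh Lc) j) (diagK fun p a => X2s j α κ' u' κ u p a - X2s j α κ u κ' u' p a) +
                (1 / 2 : ℝ) • (Δ j α κ u κ' u' + Δ j α κ' u' κ u)))) (GcombSh Lc j) -
                (comp (sandwichDefect (GcombSh Lc j) (bhKStepSh 3 Lc (Dsh Lc) j)
                      (diagK fun p c => ∑ ι, ∑' v, colH (GcombSh Lc j) Lc κ u ι v * (γ j * ctGenM 3 (bhK Lc + Dsh Lc) α Lc ι v p c)))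
                    (comp (dM (GcombSh Lc j) Lc (SpureRecOf 3 Lc (symVhSAt (ctr 4 Lc) 3 Lc rfl) (symHessFFAt (ctr 4 Lc) Lc) (GcombSh Lc) ((Lc : ℝ) ^ 4) (-((Lc : ℝ) ^ 8 / 2)) cΛ j) (M1Of 3 Lc (symHessFFAt (ctr 4 Lc) Lc) cΛ j) κ' u') (GcombSh Lc j) -
                      diagK fun p c => ∑ ι, ∑' v, colH (GcombSh Lc j) Lc κ' u' ι v * (γ j * ctGenM 3 (bhK Lc + Dsh Lc) α Lc ι v p c))
                  + comp (comp (GcombSh Lc j) (dM (GcombSh Lc j) Lc (SpureRecOf 3 Lc (symVhSAt (ctr 4 Lc) 3 Lc rfl) (symHessFFAt (ctr 4 Lc) Lc) (GcombSh Lc) ((Lc : ℝ) ^ 4) (-((Lc : ℝ) ^ 8 / 2)) cΛ j) (M1Of 3 Lc (symHessFFAt (ctr 4 Lc) Lc) cΛ j) κ u +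
                      conjV (bhKStepSh 3 Lc (Dsh Lc) j) (diagK fun p c => ∑ ι, ∑' v, colH (GcombSh Lc j) Lc κ u ι v * (γ j * ctGenM 3 (bhK Lc + Dsh Lc) α Lc ι v p c))))
                    (sandwichDefect (GcombSh Lc j) (bhKStepSh 3 Lc (Dsh Lc) j)
                      (diagK fun p c => ∑ ι, ∑' v, colH (GcombSh Lc j) Lc κ' u' ι v * (γ j * ctGenM 3 (bhK Lc + Dsh Lc) α Lc ι v p c)))
                  + comp (sandwichDefect (GcombSh Lc j) (bhKStepSh 3 Lc (Dsh Lc) j)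
                      (diagK fun p c => ∑ ι, ∑' v, colH (GcombSh Lc j) Lc κ' u' ι v * (γ j * ctGenM 3 (bhK Lc + Dsh Lc) α Lc ι v p c)))
                    (comp (dM (GcombSh Lc j) Lc (SpureRecOf 3 Lc (symVhSAt (ctr 4 Lc) 3 Lc rfl) (symHessFFAt (ctr 4 Lc) Lc) (GcombSh Lc) ((Lc : ℝ) ^ 4) (-((Lc : ℝ) ^ 8 / 2)) cΛ j) (M1Of 3 Lc (symHessFFAt (ctr 4 Lc) Lc) cΛ j) κ u) (GcombSh Lc j) -
                      diagK fun p c => ∑ ι, ∑' v, colH (GcombSh Lc j) Lc κ u ι v * (γ j * ctGenM 3 (bhK Lc + Dsh Lc) α Lc ι v p c))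
                  + comp (comp (GcombSh Lc j) (dM (GcombSh Lc j) Lc (SpureRecOf 3 Lc (symVhSAt (ctr 4 Lc) 3 Lc rfl) (symHessFFAt (ctr 4 Lc) Lc) (GcombSh Lc) ((Lc : ℝ) ^ 4) (-((Lc : ℝ) ^ 8 / 2)) cΛ j) (M1Of 3 Lc (symHessFFAt (ctr 4 Lc) Lc) cΛ j) κ' u' +
                      conjV (bhKStepSh 3 Lc (Dsh Lc) j) (diagK fun p c => ∑ ι, ∑' v, colH (GcombSh Lc j) Lc κ' u' ι v * (γ j * ctGenM 3 (bhK Lc + Dsh Lc) α Lc ι v p c))))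
                    (sandwichDefect (GcombSh Lc j) (bhKStepSh 3 Lc (Dsh Lc) j)
                      (diagK fun p c => ∑ ι, ∑' v, colH (GcombSh Lc j) Lc κ u ι v * (γ j * ctGenM 3 (bhK Lc + Dsh Lc) α Lc ι v p c)))))) +
            RBr (j + 1) α κ u κ' u' +
            conjV (mmRead Lc (GcombSh (d := 3) Lc j))
              (diagK fun p c => ((Lc : ℝ) ^ 8) * wV4 3 Lc (j + 1) * mmSym Lc (X2s j α κ u κ' u') p c - wVH 3 Lc (j + 1) * h2 (j + 1) α κ u κ' u' p c)))
    -- the cancellation of the chart-(II) defect against the W-REMAINDER `Rm_j` (the compensator is now IDENTIFIED: `Wc := Rm`, `X₂ := diagK X2s`) — the (N8) object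
    (hRm0 : ∀ (j : ℕ) (α μ : Fin 4) (y : Fin 4 → ℤ) (ν : Fin 4) (y' : Fin 4 → ℤ),
      tadpole (GcombSh Lc j)
        ((1 / 2 : ℝ) • conjV (bhKStepSh 3 Lc (Dsh Lc) j) (diagK fun p a => X2s j α ν y' μ y p a - X2s j α μ y ν y' p a) +
          (1 / 2 : ℝ) • (Δ j α μ y ν y' + Δ j α ν y' μ y)) = 0)
    -- the route theorem's own binders, verbatim
    (a : ℝ) (ha : 0 < a)
    (h12 : B5.Prop12Printed (fam (fun i : ℕ+ × ℕ => ((i.1 : ℕ+) : ℕ)) (fun i => i.1.pos) MvE a ha))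
    (h126 : B5.Kernel126_127Printed (kfam (fun i : ℕ+ × ℕ => ((i.1 : ℕ+) : ℕ)) MvE))
    {L : Type*} {SL : Finset L} (hSL : SL.Nonempty) (k : L → Fin 4) {μ ν : Fin 4} (hμν : μ ≠ ν) {Nc : ℝ} (hNc : Nc ≠ 0)
    (Jc : ∀ m : ℕ, JetData 3 (Lc ^ m))
    (htel : D1Tel Lc (JsB12CombShSym hLc N (symTablesAn1S2 3 Lc cΛ) cΛ cB) Jc)
    {cc : ℝ} {Mw' : ℕ → ℕ} (hc : 1 ≤ cc) (hMwin : ∀ L : ℕ, 2 ≤ L → 1 ≤ Mw' L ∧ (L : ℝ) ≤ cc * Mw' L) (hML : ∀ L : ℕ, 2 ≤ L → Mw' L ≤ L)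
    (hrep : D1Rep Lc Jc Nc μ ν a SL k) :
    D1Drift Lc (JsB12CombShSym hLc N (symTablesAn1S2 3 Lc cΛ) cΛ cB) Nc μ ν := by
  subst hcB
  have hLc1 : 1 ≤ Lc := le_trans one_le_two hL2
  exact d1Drift_JsB12CombShSym_an1TablesS2_of_bordMixWard_bordReflLetters_D1Tel_D1Rep hLc hL2 hN cΛ (-((Lc : ℝ) ^ 12 / 4)) 0 0 (symRMAn1 Lc cΛ)
    (hcls_sym hLc1 cΛ 0) (fun j => hcls_sym hLc1 cΛ (j + 1)) hRBp_zero hRBp_zero (hRMp_sym_of_lock hΛ) (hBord0_sym hLc) (hBord0''_sym hLc)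
    (hBordS_sym hLc) (hBordS''_sym hLc) (hM₂_sym cΛ) hVfm hVmf hVmm hHr γ hγ hlock2 h2 R2 h0 X2s Δ hsplit hDg hX2L hΔL RBr hRBrff hBfm hBmf hBmm hR2succ
    hRm0 a ha h12 h126 hSL k hμν hNc Jc htel hc hMwin hML hrep

end Summit.QuantumFields.BalabanUV.Beta.CombChartJointEndReflTablesAn1S2MW

end
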